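import Mathlib.Analysis.SpecialFunctions.Trigonometric.Cotangent
import Mathlib.Analysis.PSeries
import HarnessLib

/-!
# The fermionic Matsubara frequency sum `Σₙ 1/(ωₙ² + E²) = β tanh(βE/2)/(4E)`

Topic `Literature/Analysis/SpecialFunctions`.  The finite-temperature formalism of
Benfatto–Giuliani–Mastropietro 2006, §2.1 ((2.2)–(2.5): fields `ψ̂^±_{k}`, `k₀ = (2n+1)π/β` the
fermionic Matsubara frequencies, propagator `ĝ(k) = 1/(-ik₀ + ε(k⃗) - μ)`) rests on the classical
Matsubara sums; the basic one, from which the Fermi function `f_β(E) = (1 + e^{βE})⁻¹ =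
½ - (2E/β) Σ_{n ≥ 0} 1/(ωₙ² + E²)` follows, is proved here from Mathlib's Mittag-Leffler expansion
of the cotangent (`Complex.cot_series_rep'`):

* `tsum_one_div_sq_add_sq` — `Σ_{n ≥ 0} 1/((n + ½)² + a²) = π tanh(πa)/(2a)` (`a ≠ 0` real);
* `tsum_one_div_matsubara_sq_add_sq` — with `ωₙ = (2n+1)π/β`, `β > 0`, `E ≠ 0`:
  `Σ_{n ≥ 0} 1/(ωₙ² + E²) = β tanh(βE/2)/(4E)`;
* `fermiFunction_eq_half_sub_tsum` — `(1 + e^{βE})⁻¹ = ½ - (2E/β) Σ_{n ≥ 0} 1/(ωₙ² + E²)`.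

Everything is proved; no named fact. [folklore]

## Sources

G. Benfatto, A. Giuliani, V. Mastropietro, Ann. Henri Poincaré 7 (2006), §2.1 (2.2)–(2.5)
(`BenfattoGiulianiMastropietro2006`); A. L. Fetter, J. D. Walecka, *Quantum Theory of
Many-Particle Systems* (1971), §25 (evaluation of frequency sums). [folklore]
-/

noncomputable section

open Complex Filter Finset
open scoped Real Topology

namespace Literature.Analysis.SpecialFunctions

/-! ### Real summability -/

/-- `Σ 1/((n + ½)² + a²)` converges. [folklore] -/
theorem summable_one_div_sq_add_sq (a : ℝ) : Summable fun n : ℕ => 1 / (((n : ℝ) + 1 / 2) ^ 2 + a ^ 2) := by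
  have h4 : Summable fun n : ℕ => 4 * (1 / ((n : ℝ) + 1) ^ 2) := by
    refine Summable.mul_left 4 ?_
    have h := (summable_nat_add_iff 1).2 (Real.summable_one_div_nat_pow.2 one_lt_two)
    simpa using h
  refine Summable.of_nonneg_of_le (fun n => by positivity) (fun n => ?_) h4
  have hn : (0 : ℝ) ≤ n := n.cast_nonneg
  rw [div_le_iff₀ (by positivity), ← sub_nonneg]
  have : 4 * (1 / ((n : ℝ) + 1) ^ 2) * (((n : ℝ) + 1 / 2) ^ 2 + a ^ 2) - 1 =
      ((4 * ((n : ℝ) + 1 / 2) ^ 2 - ((n : ℝ) + 1) ^ 2) + 4 * a ^ 2) / ((n : ℝ) + 1) ^ 2 := by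
    field_simp
    ring
  rw [this]
  refine div_nonneg ?_ (by positivity)
  nlinarith [sq_nonneg a]

/-! ### The complex computation from the cotangent expansion -/

/-- `½ - ia` is not an integer. [folklore] -/
theorem half_sub_mem_integerComplement (a : ℝ) : (1 / 2 - I * a : ℂ) ∈ Complex.integerComplement := by
  rw [Complex.mem_integerComplement_iff]
  rintro ⟨n, hn⟩
  have h := congrArg Complex.re hn
  simp at h
  have h2 : (2 * n : ℤ) = (1 : ℤ) := by exact_mod_cast (by linarith : (2 * n : ℝ) = 1)
  omega

/-- `π cot(π(½ - ia)) = iπ tanh(πa)`. [folklore] -/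
theorem pi_mul_cot_pi_mul_half_sub (a : ℝ) :
    (π : ℂ) * Complex.cot (π * (1 / 2 - I * a)) = I * π * Complex.tanh (π * a) := by
  have h : (π : ℂ) * (1 / 2 - I * a) = π / 2 - (π * a) * I := by ring
  rw [h, Complex.cot_eq_cos_div_sin, Complex.cos_pi_div_two_sub, Complex.sin_pi_div_two_sub,
    ← Complex.tan_eq_sin_div_cos, Complex.tan_mul_I]
  ring

/-- The summand `Aₙ = 1/(n + ½ - ia)`. [folklore] -/
def termA (a : ℝ) (n : ℕ) : ℂ := 1 / ((n : ℂ) + 1 / 2 - I * a)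

/-- The summand `Bₙ = 1/(n + ½ + ia)`. [folklore] -/
def termB (a : ℝ) (n : ℕ) : ℂ := 1 / ((n : ℂ) + 1 / 2 + I * a)

/-- The denominator of `Aₙ` does not vanish. [folklore] -/
theorem termA_den_ne_zero (a : ℝ) (n : ℕ) : ((n : ℂ) + 1 / 2 - I * a) ≠ 0 := by
  intro h; have := congrArg Complex.re h; simp at this; linarith

/-- The denominator of `Bₙ` does not vanish. [folklore] -/
theorem termB_den_ne_zero (a : ℝ) (n : ℕ) : ((n : ℂ) + 1 / 2 + I * a) ≠ 0 := by
  intro h; have := congrArg Complex.re h; simp at this; linarith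

/-- `Aₙ - Bₙ = 2ia/((n + ½)² + a²)`. [folklore] -/
theorem termA_sub_termB (a : ℝ) (n : ℕ) :
    termA a n - termB a n = 2 * I * a * ((1 / (((n : ℝ) + 1 / 2) ^ 2 + a ^ 2) : ℝ) : ℂ) := by
  have h3 : (((n : ℂ) + 1 / 2) ^ 2 + (a : ℂ) ^ 2) = ((n : ℂ) + 1 / 2 - I * a) * ((n : ℂ) + 1 / 2 + I * a) := by
    ring_nf; rw [Complex.I_sq]; ring
  have hne : (((n : ℂ) + 1 / 2) ^ 2 + (a : ℂ) ^ 2) ≠ 0 := by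
    rw [h3]; exact mul_ne_zero (termA_den_ne_zero a n) (termB_den_ne_zero a n)
  rw [termA, termB, div_sub_div _ _ (termA_den_ne_zero a n) (termB_den_ne_zero a n), ← h3]
  push_cast
  field_simp
  ring

/-- Mathlib's cotangent term at `½ - ia` is `A_{n+1} - Bₙ`. [folklore] -/
theorem cotTerm_eq (a : ℝ) (n : ℕ) :
    (1 / ((1 / 2 - I * a : ℂ) - (n + 1)) + 1 / ((1 / 2 - I * a : ℂ) + (n + 1))) = termA a (n + 1) - termB a n := by
  rw [termA, termB]
  have h1 : ((1 / 2 - I * a : ℂ) - (n + 1)) = -((n : ℂ) + 1 / 2 + I * a) := by ring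
  have h2 : ((1 / 2 - I * a : ℂ) + (n + 1)) = (((n + 1 : ℕ) : ℂ) + 1 / 2 - I * a) := by push_cast; ring
  rw [h1, h2, one_div_neg_eq_neg_one_div]
  ring

/-- `Aₙ → 0`. [folklore] -/
theorem tendsto_termA (a : ℝ) : Tendsto (termA a) atTop (𝓝 0) := by
  rw [tendsto_zero_iff_norm_tendsto_zero]
  have hbound : ∀ n : ℕ, ‖termA a n‖ ≤ 2 * (1 / ((n : ℝ) + 1)) := fun n => by
    rw [termA, norm_div, norm_one]
    have hre : ((n : ℝ) + 1 / 2) ≤ ‖((n : ℂ) + 1 / 2 - I * a)‖ := by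
      have h := Complex.abs_re_le_norm ((n : ℂ) + 1 / 2 - I * a)
      have hre' : ((n : ℂ) + 1 / 2 - I * a).re = (n : ℝ) + 1 / 2 := by simp
      rw [hre', abs_of_nonneg (by positivity)] at h
      exact h
    have hpos : (0 : ℝ) < (n : ℝ) + 1 / 2 := by positivity
    calc 1 / ‖((n : ℂ) + 1 / 2 - I * a)‖ ≤ 1 / ((n : ℝ) + 1 / 2) := one_div_le_one_div_of_le hpos hre
      _ ≤ 2 * (1 / ((n : ℝ) + 1)) := by
          rw [show 2 * (1 / ((n : ℝ) + 1)) = 2 / ((n : ℝ) + 1) by ring, div_le_div_iff₀ hpos (by positivity)]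
          linarith
  refine squeeze_zero (fun n => norm_nonneg _) hbound ?_
  simpa using (tendsto_one_div_add_atTop_nhds_zero_nat).const_mul (2 : ℝ)

/-- **`Σ_{n ≥ 0} (Aₙ - Bₙ) = iπ tanh(πa)`** (re-pairing of the cotangent expansion at `½ - ia`).
[folklore] -/
theorem hasSum_termA_sub_termB (a : ℝ) : HasSum (fun n => termA a n - termB a n) (I * π * Complex.tanh (π * a)) := by
  set x : ℂ := 1 / 2 - I * a with hx
  have hxZ : x ∈ Complex.integerComplement := half_sub_mem_integerComplement a
  -- Mathlib: `π cot(πx) - 1/x = Σ' (A (n+1) - B n)`, and the summability of these terms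
  have hsumm : Summable fun n : ℕ => termA a (n + 1) - termB a n := by
    have h := summable_cotTerm hxZ
    refine h.congr fun n => ?_
    rw [cotTerm, ← cotTerm_eq a n]
  have hcot : ∑' n : ℕ, (termA a (n + 1) - termB a n) = π * Complex.cot (π * x) - 1 / x := by
    rw [cot_series_rep' hxZ]
    exact tsum_congr fun n => (cotTerm_eq a n).symm
  -- the telescoping series `Σ (A n - A (n+1)) = A 0`
  have hAB : Summable fun n : ℕ => termA a n - termB a n := by
    have h := (summable_ofReal.2 (summable_one_div_sq_add_sq a)).mul_left (2 * I * a)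
    refine h.congr fun n => ?_
    rw [termA_sub_termB]
  have htel_summ : Summable fun n : ℕ => termA a n - termA a (n + 1) := by
    have h := hAB.sub hsumm
    refine h.congr fun n => ?_
    ring
  have htel : HasSum (fun n : ℕ => termA a n - termA a (n + 1)) (termA a 0) := by
    rw [htel_summ.hasSum_iff_tendsto_nat]
    have heq : (fun N : ℕ => ∑ i ∈ range N, (termA a i - termA a (i + 1))) = fun N => termA a 0 - termA a N :=
      funext fun N => Finset.sum_range_sub' (termA a) N
    rw [heq]
    simpa using (tendsto_const_nhds (x := termA a 0)).sub (tendsto_termA a)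
  -- assemble
  have hA0 : termA a 0 = 1 / x := by rw [termA, hx]; push_cast; ring
  have hval : termA a 0 + (π * Complex.cot (π * x) - 1 / x) = I * π * Complex.tanh (π * a) := by
    rw [hA0, hx, pi_mul_cot_pi_mul_half_sub]; ring
  rw [← hval, ← hcot]
  have h := htel.add hsumm.hasSum
  have hfun : (fun n : ℕ => termA a n - termB a n) = fun n => (termA a n - termA a (n + 1)) + (termA a (n + 1) - termB a n) :=
    funext fun n => by ring
  rw [hfun]
  exact h

/-! ### Real forms -/

/-- **`Σ_{n ≥ 0} 1/((n + ½)² + a²) = π tanh(πa)/(2a)`** for real `a ≠ 0`. [folklore] -/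
theorem tsum_one_div_sq_add_sq {a : ℝ} (ha : a ≠ 0) :
    ∑' n : ℕ, 1 / (((n : ℝ) + 1 / 2) ^ 2 + a ^ 2) = π * Real.tanh (π * a) / (2 * a) := by
  have h := (hasSum_termA_sub_termB a).tsum_eq
  have h2 : ∑' n : ℕ, (termA a n - termB a n) =
      2 * I * a * ((∑' n : ℕ, 1 / (((n : ℝ) + 1 / 2) ^ 2 + a ^ 2) : ℝ) : ℂ) := by
    rw [Complex.ofReal_tsum, ← tsum_mul_left]
    exact tsum_congr fun n => termA_sub_termB a n
  have h3 := h2.symm.trans h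
  have ha' : (a : ℂ) ≠ 0 := Complex.ofReal_ne_zero.2 ha
  have hI : (2 * I * a : ℂ) ≠ 0 := mul_ne_zero (mul_ne_zero two_ne_zero Complex.I_ne_zero) ha'
  have h4 := (eq_inv_mul_iff_mul_eq₀ hI).2 h3
  apply Complex.ofReal_injective
  rw [h4]
  push_cast
  field_simp

/-- **The fermionic Matsubara sum**: with `ωₙ = (2n+1)π/β` (`β > 0`) and `E ≠ 0`,
`Σ_{n ≥ 0} 1/(ωₙ² + E²) = β tanh(βE/2)/(4E)` (the sum over all `n ∈ ℤ` is twice this).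
[cite: BenfattoGiulianiMastropietro2006, §2.1 (2.2)-(2.5)] -/
theorem tsum_one_div_matsubara_sq_add_sq {β E : ℝ} (hβ : 0 < β) (hE : E ≠ 0) :
    ∑' n : ℕ, 1 / (((2 * n + 1) * π / β) ^ 2 + E ^ 2) = β * Real.tanh (β * E / 2) / (4 * E) := by
  have hπ : (π : ℝ) ≠ 0 := Real.pi_ne_zero
  set a : ℝ := β * E / (2 * π) with ha_def
  have ha : a ≠ 0 := div_ne_zero (mul_ne_zero hβ.ne' hE) (by positivity)
  have hterm : ∀ n : ℕ, 1 / (((2 * n + 1) * π / β) ^ 2 + E ^ 2) =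
      (β / (2 * π)) ^ 2 * (1 / (((n : ℝ) + 1 / 2) ^ 2 + a ^ 2)) := by
    intro n
    rw [ha_def]
    field_simp
  have hπa : π * a = β * E / 2 := by rw [ha_def]; field_simp
  rw [tsum_congr hterm, tsum_mul_left, tsum_one_div_sq_add_sq ha, hπa, ha_def]
  field_simp
  ring

/-- `tanh (x/2) = (eˣ - 1)/(eˣ + 1)`. [folklore] -/
theorem tanh_half_eq (x : ℝ) : Real.tanh (x / 2) = (Real.exp x - 1) / (Real.exp x + 1) := by
  rw [Real.tanh_eq_sinh_div_cosh, Real.sinh_eq, Real.cosh_eq]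
  have ht : Real.exp x = Real.exp (x / 2) * Real.exp (x / 2) := by rw [← Real.exp_add]; ring_nf
  have hpos : 0 < Real.exp (x / 2) := Real.exp_pos _
  rw [ht, Real.exp_neg]
  field_simp

/-- **The Fermi function as a Matsubara sum**: `(1 + e^{βE})⁻¹ = ½ - (2E/β) Σ_{n ≥ 0} 1/(ωₙ² + E²)`
(`β > 0`, `E ≠ 0`). [folklore] -/
theorem fermiFunction_eq_half_sub_tsum {β E : ℝ} (hβ : 0 < β) (hE : E ≠ 0) :
    (1 + Real.exp (β * E))⁻¹ = 1 / 2 - 2 * E / β * ∑' n : ℕ, 1 / (((2 * n + 1) * π / β) ^ 2 + E ^ 2) := by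
  rw [tsum_one_div_matsubara_sq_add_sq hβ hE, show β * E / 2 = (β * E) / 2 from rfl, tanh_half_eq]
  have hpos : 0 < Real.exp (β * E) + 1 := by positivity
  field_simp
  ring

/-! ### The two-sided sum over all Matsubara frequencies -/

/-- Summability of `1/(ωₙ² + E²)` over `n ≥ 0`. [folklore] -/
theorem summable_one_div_matsubara_sq_add_sq {β : ℝ} (hβ : 0 < β) (E : ℝ) :
    Summable fun n : ℕ => 1 / (((2 * n + 1) * π / β) ^ 2 + E ^ 2) := by
  have hπ : (π : ℝ) ≠ 0 := Real.pi_ne_zero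
  set a : ℝ := β * E / (2 * π) with ha_def
  have hterm : ∀ n : ℕ, 1 / (((2 * n + 1) * π / β) ^ 2 + E ^ 2) =
      (β / (2 * π)) ^ 2 * (1 / (((n : ℝ) + 1 / 2) ^ 2 + a ^ 2)) := by
    intro n
    rw [ha_def]
    field_simp
  simp_rw [hterm]
  exact (summable_one_div_sq_add_sq a).mul_left _

/-- **The fermionic Matsubara sum over all frequencies**: with `ωₙ = (2n+1)π/β`, `n ∈ ℤ` (`β > 0`,
`E ≠ 0`), `Σ_{n ∈ ℤ} 1/(ωₙ² + E²) = β tanh(βE/2)/(2E)` — the negative frequencies `ω_{-n-1} = -ωₙ`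
contribute the same as the nonnegative ones. [folklore] -/
theorem tsum_int_one_div_matsubara_sq_add_sq {β E : ℝ} (hβ : 0 < β) (hE : E ≠ 0) :
    ∑' n : ℤ, 1 / (((2 * n + 1) * π / β) ^ 2 + E ^ 2) = β * Real.tanh (β * E / 2) / (2 * E) := by
  have hs := summable_one_div_matsubara_sq_add_sq hβ E
  have hv := tsum_one_div_matsubara_sq_add_sq hβ hE
  have h0 : HasSum (fun n : ℕ => 1 / (((2 * n + 1) * π / β) ^ 2 + E ^ 2)) (β * Real.tanh (β * E / 2) / (4 * E)) := by
    rw [← hv]; exact hs.hasSum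
  set f : ℤ → ℝ := fun n => 1 / (((2 * n + 1) * π / β) ^ 2 + E ^ 2) with hf
  have hf1 : (fun n : ℕ => f n) = fun n : ℕ => 1 / (((2 * n + 1) * π / β) ^ 2 + E ^ 2) := by
    funext n; rw [hf]; push_cast; ring_nf
  have hf2 : (fun n : ℕ => f (-(n + 1))) = fun n : ℕ => 1 / (((2 * n + 1) * π / β) ^ 2 + E ^ 2) := by
    funext n; rw [hf]; push_cast; ring_nf
  have h1 : HasSum (fun n : ℕ => f n) (β * Real.tanh (β * E / 2) / (4 * E)) := by rw [hf1]; exact h0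
  have h2 : HasSum (fun n : ℕ => f (-(n + 1))) (β * Real.tanh (β * E / 2) / (4 * E)) := by rw [hf2]; exact h0
  have h := HasSum.of_nat_of_neg_add_one h1 h2
  rw [h.tsum_eq]
  ring

end Literature.Analysis.SpecialFunctions
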